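import Literature.MathematicalPhysics.QuantumFieldTheory.Balaban1983to89.B9Cor36GpCubeLocAtMember
import Literature.MathematicalPhysics.QuantumFieldTheory.Balaban1983to89.B9Cor36SiteSandwichTransferBlocks

/-!
# `Balaban1983to89.B9Cor36GpCubeLocAtBlocks` — [Balaban1985BackgroundPropagators] COROLLARY 3.6 p. 408 AT ONE COVER CUBE, READ ON ALL THE MEMBER's BLOCKS:
# the four (3.42) block majorants of the site-sector cube letter of design (R) `η²O_□ = χ_□R(u_□)⁻¹·η²G′_□(Ṽ_□)·R(u_□)χ_□` (lit-balaban-p33's `locLetterY`),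
# with the MEMBER's derivatives `η⁻¹∇_{U,μ}`, `−η⁻¹∇*_{U,μ}`, `η⁻²Δ_U`, over the ALL-BLOCKS geometry `geoBK i` keyed by the block map `Δ(·)` (`blkOf`) —
# from ONE cover cube's (3.35) datum, for EVERY member above one threshold (cornered members included; NO section `ιB` of the carrier-index map):
# the section-free twin of p33's FILE 7b-D2 `B9Cor36GpCubeLocAtMember.eBlock_locLetterY` stopped BEFORE the index-keyed writer — exactly the input
# tables h0–h3 of dag-n06-c's block-keyed (3.42) bridge `B9Local342OfBlocksXSK` (rows 18 of the pub-ymgap N06 certificate, all members; LOCATED-28)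

T. Bałaban, *Propagators for lattice gauge theories in a background field*, Commun. Math. Phys. **99** (1985) 389–434 [`Balaban1985BackgroundPropagators`, "B9"]
(held `paper:balaban1985-cmp99-background-propagators`; journal page = PDF page + 388); [4] = T. Bałaban, *Propagators and renormalization transformations for
lattice gauge theories. II*, Commun. Math. Phys. **96** (1984) 223–250 [`Balaban1984PropagatorsII`].

statement-level skeleton of published theorems with citation tags; proofs where landed; nothing here is a claim about the Yang–Mills mass gap

THE PRINTED LOCUS (verbatim).  Cor. 3.6 p. 408 l. 1–14: *«Let us assume that a gauge field U … is regular on each cube □̃ from the cover π′_j … in the sense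
described above, i.e. (3.35), (3.37) hold.  Then the operators G_□(U), G′_□(U) defined by the sequence {Ω_n(□)} satisfy (3.42)–(3.47) for x, y, y′ ∈ □̃ …
all the results of these theorems are gauge invariant, so they hold for the configuration U also»*; p. 408 l. 20–25 (*«for each cube □ … there exists a gauge
transformation u defined on □̃⁵»* — the datum is PER CUBE); (3.87)–(3.89) p. 409; p. 410 l. 14–15 (*«A propagator G′_□ depends on U restricted to
Ω₀(□) ⊂ □̃⁵»*); Thm 3.1 (3.42) p. 397 («for x ∈ Δ(y), y ∈ Λ_j, supp λ ⊂ Δ(y′) … y, y′ ∈ 𝔅»); p. 393 l. 12–18 («Ω_j∖Ω_{j+1} = Bʲ(Λ_j)» — the blocks ARE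
indexed by `𝔅`); [4] (2.51)–(2.55) p. 232, (2.45)–(2.46) p. 231.

WHY THIS FILE (pub-ymgap node N06 [B9]; dag-n06-d's rows-18 re-key «h36 ↦ ONE displayed block-keyed table hypothesis, h0–h3 VERBATIM at the record's letter»,
fleet INBOX 2026-08-30T09:08:23Z; LOCATED-28).  p33's FILE 7b-D2 proves, from one cover cube's (3.35) datum `(u, A, Q, C, ξ, Λ)` in r05's
`gp_cube_entries_at_locCfg` form, the four (3.42) block majorants of `η²O_□` with the member's derivatives — but over node00-def-Y's INDEX-keyed geometry
`toB6 (geo9K i)` through a SECTION `ιB` of `β` (`β ∘ ιB = id`), and then WRITES them into the `EBlock (kernelFamilySInv …)` currency, which reads `range β`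
on both sides.  At the cornered members of the record's family no section exists (`Node00.MemberYCornered`), so that supply is silent there, while the N06
certificate is an ALL-MEMBERS statement.  The all-members (3.42) currency of rows 18 is the BLOCK-keyed one — [4]-(2.51) majorants over the all-blocks
geometry `geoBK i` (`B9SectBAllBlocksGeometryY`; sites = all blocks `𝔅`, `len(Δ) = L^{j(Δ)}η`, `dist = d_T`) keyed by `blkOf`, consumed by dag-n06-c's
`B9Local342OfBlocksXSK.hasMajorant_GcoS_of_blocks` ∕ `…_DcoS_GcoS_…` ∕ `…_GcoS_DscoS_…` ∕ `…_LcoS_GcoS_…` (inputs h0–h3, generic cube letter `O`, `hG`, `hL`)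
and transferred to the record's index key by `B9BlockKeyTransferXSK`.  THIS FILE is FILE 7b-D2 in that key, section-free: ★★★ `hasMajorant_locLetterY_blocks`
— for every member above ONE threshold (r05's `M₀, N₀, T₀` and the scale-transfer threshold `4 log L ∕ ((9∕5000)δ_C) ≤ R·M₁`), every cover cube and every
datum: `IsUnit Δ′_{a,□}(Ṽ_□)` AND the four block majorants over `toB6 (geoBK i) Rr Hp` keyed `(z, j) ↦ Δ(z)` of `conj b (Gmem i □ u A)` (`= η²O_□`,
`Gmem_apply`), `conj b (η⁻¹∇_{U,μ}-letter)·conj b (Gmem …)`, `conj b (Gmem …)·conj b (−η⁻¹∇*_{U,μ}-letter)`, `conj b (Lscaled i U)·conj b (Gmem …)`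
(`Lscaled_apply`: `η⁻²Δ_U`) with kernels `B₀·ℓ(a)²·e^{−δd}`, `B₀·ℓ(a)·e^{−δd}` (×2), `B₀·1·e^{−δd}` — LITERALLY the shapes h0–h3 of `B9Local342OfBlocksXSK` at
`O □ := locLetterY i □ parSymY u χ_□ Ṽ_□`, `G := Gmem`, `L := Lscaled i U`, `Uc := UboxY i U`, `η := (kGeo i).eta`.  PROOF: p33's, verbatim, with the section
deleted — the Leibniz ∕ plateau identities `diffLetter_inl_mul_Gmem`, `Gmem_mul_diffLetter_inr`, `Lscaled_mul_Gmem`, the multiplier sizes `chiY_weights`, the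
supports `nearH_of_chiY_ne_zero₃` (p33 FILE 7b-D1∕7b-D2 BY NAME), each term transferred by dag-n06-c's section-free `B9Cor36SiteSandwichTransferBlocks`
(`…_decay_blocks` ∕ `…_decay_src_blocks`), r05's cube entries `gp_cube_entries_at_locCfg` as the input; one constant `B₀ = Bc(d, L, M₂Σ‖b‖, B_f)` and the
rate `δ = (1 − 9∕5000)δ_C`.

HONEST SCOPE / NOT CLAIMED.  Composition of landed theorems (r05 FILE 5b, p33 FILES 7b-D1∕7b-D2 identities, dag-n06-c T3); no estimate added.  DISPLAYED: the
per-cube (3.35) datum in r05's form (`Q ⊇ NearC_□(35S_j∕8 + 1)`; which class cube supplies it is p33 FILE 4's open question (Q1) ∕ lit-balaban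
`B9Cor36GpCoverBindersUnitary.exists_cubeData_of_reg335Cubes`, not decided here), `u` bi-contractive, the member thresholds (existential; «For M sufficiently
large»), the (3.37) smallness `α₁ ≤ min(a₁, 1∕4)`.  «Cornered members» are OUR bookkeeping ([B7] (4) p. 18 ∕ [B9] p. 393 assume complete blocks; lit-balaban
OWNER WORD IR-N06-SECTION 2026-08-30: consumer-side object).  Sup-entries (3.42)₁₋₄ only, at ONE cube letter; the Hölder entries (3.43)–(3.47), the bond
sector, the glueing (3.87)–(3.90), the fold into the N06 certificate are NOT here.  Finite 𝕋 members; count-neutral; rows 18 NOT thereby derived; N06 NOT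
discharged; nothing on `d = 4`, the continuum, reflection positivity, the mass gap or Clay.  No `sorry`, no `axiom`, no `… : Prop` fact, no `instance`, no
`notation`, no `def`.  NEW file; nothing landed is modified.  Cell `pub-ymgap` (D-0062), seat `pub-ymgap-dag-n06-c` (gen 23), 2026-08-30; `--supports
stmt-QuantumFields-27364`.  Net new unproved facts: 0.

RELATED IN THE TREE, NOT DUPLICATED (searched 2026-08-30, `rg` over `lean/Literature` + `lean/Summits` for the basename and the decl name: 0 hits): p33
`B9Cor36GpCubeLocAtMember.eBlock_locLetterY` (index-keyed through `ιB`, written into `EBlock`; its §1–§4 letters and identities USED BY NAME), lit-balaban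
`B9Cor36GpCoverBinders` ∕ `…Unitary` (the cover-level packaging of the same, `ιB hι` displayed), dag-n06-c `B9Local342OfEBlockInv` (the `EBlock`-currency
bridge, SC members only) — the present file is the all-members feed that by-passes the `EBlock` currency.
-/

noncomputable section

namespace Literature.MathematicalPhysics.QuantumFieldTheory.Balaban1983to89.B9Cor36GpCubeLocAtBlocks

open Literature.MathematicalPhysics.QuantumFieldTheory.Balaban1983to89
open Literature.MathematicalPhysics.QuantumFieldTheory.Balaban1983to89.B4PartitionUnity22 (thetaProf D1 D2 D1_nonneg D2_nonneg contDiff_thetaProf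
  hasCompactSupport_thetaProf)
open Literature.MathematicalPhysics.QuantumFieldTheory.Balaban1983to89.B6RandomWalk (HasMajorant hasMajorant_mono hasMajorant_add hasMajorant_zero)
open Literature.MathematicalPhysics.QuantumFieldTheory.Balaban1983to89.B9Thm34Ext (toB6)
open Literature.MathematicalPhysics.QuantumFieldTheory.Balaban1983to89.B9Eq39Adjoint (R R_zero R_smul covD fluct)
open Literature.MathematicalPhysics.QuantumFieldTheory.Balaban1983to89.B9Eq352DivFormLetters (conj conj_mul conj_sub conj_neg)
open Literature.MathematicalPhysics.QuantumFieldTheory.Balaban1983to89.B9Eq352GradLetters (diffLetter diffLetter_inl diffLetter_inr conj_add conj_finset_sum)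
open Literature.MathematicalPhysics.QuantumFieldTheory.Balaban1983to89.B6KLevelCensusIndexV1 (KIdx kGeo)
open Literature.MathematicalPhysics.QuantumFieldTheory.Balaban1983to89.B6Cover236MultiLevelBlocks (cubes)
open Literature.MathematicalPhysics.QuantumFieldTheory.Balaban1983to89.B6GlobalChartV1 (PV boxEquiv)
open Literature.MathematicalPhysics.QuantumFieldTheory.Balaban1983to89.B9BackgroundsKLevelV1 (shiftsV1)
open Literature.MathematicalPhysics.QuantumFieldTheory.Balaban1983to89.B6Geom246MultiLevelBox (blkOf)
open Literature.MathematicalPhysics.QuantumFieldTheory.Balaban1983to89.B9FromB6 (decay_mono)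
open Literature.MathematicalPhysics.QuantumFieldTheory.Balaban1983to89.B9Eq360DeltaPrimeAY (AfldY)
open Literature.MathematicalPhysics.QuantumFieldTheory.Balaban1983to89.B9Eq360DeltaPrimeACubeY (blkCubeY)
open Literature.MathematicalPhysics.QuantumFieldTheory.Balaban1983to89.B9CubeLettersOpsL0 (deltaPrimeACubeY GpCubeY)
open Literature.MathematicalPhysics.QuantumFieldTheory.Balaban1983to89.B9CubeLettersBondOpsL0 (BlkCubeY)
open Literature.MathematicalPhysics.QuantumFieldTheory.Balaban1983to89.B9CubeGeometryInputs (geoCK geoCK_len_pos geoCK_eta geoCK_eta_pos RM1 N1 hST_geoCK)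
open Literature.MathematicalPhysics.QuantumFieldTheory.Balaban1983to89.B9CubeSequence408 (NearH)
open Literature.MathematicalPhysics.QuantumFieldTheory.Balaban1983to89.B9Thm37CubeCoverCommutators (cutMulY cutMulY_apply)
open Literature.MathematicalPhysics.QuantumFieldTheory.Balaban1983to89.B9Cor35GpCubeInputsAtOne (hasMajorant_neg)
open Literature.MathematicalPhysics.QuantumFieldTheory.Balaban1983to89.B9Cor36CubeCutoffs (SC NearC chiY locCfgY abs_chiY_le_one)
open Literature.MathematicalPhysics.QuantumFieldTheory.Balaban1983to89.B9Cor36GpCubeLocLetter (locLetterY)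
open Literature.MathematicalPhysics.QuantumFieldTheory.Balaban1983to89.B9Cor36GpCubeEntriesAtV (gp_cube_entries_at_locCfg)
open Literature.MathematicalPhysics.QuantumFieldTheory.Balaban1983to89.B9Cor36CutoffSecondDiff (chiY_weights nearH_of_chiY_ne_zero₃)
open Literature.MathematicalPhysics.QuantumFieldTheory.Balaban1983to89.B9Cor36GpCubeLocAtMember (Ginner Gmem Lscaled SandR conj_Ginner Gmem_apply Lscaled_apply
  diffLetter_inl_mul_Gmem Gmem_mul_diffLetter_inr Lscaled_mul_Gmem nearC_of_chiY_ne_zero₃ agree_near hasMajorant_congr_op hasMajorant_finset_sum kernel_le)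
open Literature.MathematicalPhysics.QuantumFieldTheory.Balaban1983to89.B9SectBAllBlocksGeometryY (geoBK geoBK_len_pos geoBK_dist_nonneg)
open Literature.MathematicalPhysics.QuantumFieldTheory.Balaban1983to89.B9Cor36SiteSandwichTransferBlocks (hasMajorant_conj_site_sandwich_decay_blocks
  hasMajorant_conj_site_sandwich_decay_src_blocks)
open Literature.MathematicalPhysics.QuantumFieldTheory.Balaban1983to89.Node00 (SiteY CfgY GaugeY toKT shiftY gaugeY gSiteY parSymY UboxY etaS)

variable {d ℓ : ℕ} {hd : 1 ≤ d + 1} {hL : Odd (ℓ + 1) ∧ 1 < ℓ + 1} {b₀ b₁ : ℝ}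
variable {𝔸 : Type} [NormedRing 𝔸] [NormedAlgebra ℂ 𝔸] [CompleteSpace 𝔸]
variable {ι : Type} [Fintype ι]

variable (b : Module.Basis ι ℝ 𝔸)

/-- ★★★ **COROLLARY 3.6 AT ONE COVER CUBE, READ ON ALL THE MEMBER's BLOCKS — THE FOUR (3.42) BLOCK MAJORANTS OF `η²O_□` WITH THE MEMBER's DERIVATIVES,
KEYED BY `Δ(·)`, SECTION-FREE**: there are a rate `δ > 0`, a constant `B₀ ≥ 0`, thresholds `M₀, N₀, T₀` and `a₁ > 0` — functions of `d, L, M₂, b` only — such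
that for every member above threshold, every cover cube □, every (3.35) datum `(u, A, Q, C, ξ, Λ)` of r05's form (`Q ⊇ NearC(35S_j∕8 + 1)`, `U^u = e^{iηA}` on
the bonds of `Q`, `|A| ≤ Cξ⁻¹`, `|η⁻¹∂A| ≤ Cξ⁻²` on `Q`, `ξ ≤ 5S_jη`, `L^{j+1}η ≤ Λξ`, `1 ≤ Λ`, `max C (C(1+D₁θ))Λ² ≤ min a₁ ¼`), `u` a bi-contraction, and every
walk datum `(Rr, Hp)`: `Δ′_{a,□}(Ṽ_□)` is invertible AND, over the all-blocks geometry `toB6 (geoBK i) Rr Hp` with block map `(z, j) ↦ Δ(z)`,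
`conj b(η²O_□) ≺ B₀ℓ(a)²e^{−δd(a,a′)}`, `conj b(η⁻¹∇_{U,μ})·conj b(η²O_□) ≺ B₀ℓ(a)e^{−δd}`, `conj b(η²O_□)·conj b(−η⁻¹∇*_{U,μ}) ≺ B₀ℓ(a)e^{−δd}` (all `μ`),
`conj b(η⁻²Δ_U)·conj b(η²O_□) ≺ B₀·1·e^{−δd}` — print's (3.42) «for x ∈ Δ(y), … supp λ ⊂ Δ(y′), y, y′ ∈ 𝔅» for `G′_□(U)` in [4]'s block-majorant form, every
block of `𝔅` its own key. [cite: Balaban1985BackgroundPropagators, Cor. 3.6 p.408 l.1–14 + l.20–25, (3.87)–(3.89) p.409, p.410 l.14–15, Thm 3.1 (3.42) p.397, Thm 3.4 p.400, p.393 l.12–18; Balaban1984PropagatorsII, (2.51)–(2.55) p.232, (2.45)–(2.46) p.231] -/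
theorem hasMajorant_locLetterY_blocks [NormOneClass 𝔸] [DecidableEq ι] (d ℓ : ℕ) (hℓ : 1 ≤ ℓ) (M₂ : ℝ) (hM₂ : 0 ≤ M₂)
    (hrepr : ∀ (v : 𝔸) (j : ι), |b.repr v j| ≤ M₂ * ‖v‖) :
    ∃ δ B₀ M₀ T₀ : ℝ, ∃ N₀ : ℕ, 0 < δ ∧ 0 ≤ B₀ ∧ ∃ a₁ : ℝ, 0 < a₁ ∧
    ∀ {hd : 1 ≤ d + 1} {hL : Odd (ℓ + 1) ∧ 1 < ℓ + 1} {b₀ b₁ : ℝ} (i : KIdx d ℓ hd hL b₀ b₁) (c : ↥(cubes (toKT i).D.toDomains)),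
      M₀ ≤ ((ℓ : ℝ) + 1) * (toKT i).Mh → N₀ + 1 ≤ (toKT i).R * ((ℓ + 1) * (toKT i).Mh) → T₀ ≤ RM1 i →
    ∀ (g : GaugeY 𝔸 i) (U : CfgY 𝔸 i) (A : AfldY 𝔸 i) (Q : Set (Site (PV d ℓ i.m i.K hd hL) 0)) (C ξ Λ : ℝ),
      0 ≤ C → 0 < ξ → 1 ≤ Λ → ξ ≤ 5 * (SC i c : ℝ) * (kGeo i).eta → LatticeNorms.scaleLen ((ℓ : ℝ) + 1) (kGeo i).eta (c.1.1 + 1) ≤ Λ * ξ →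
      (∀ x : Site (PV d ℓ i.m i.K hd hL) 0, NearC i c (35 * SC i c / 8 + 1) (boxEquiv i.hN x).1 → x ∈ Q) →
      (∀ (κ : Fin (d + 1)) (x : Site (PV d ℓ i.m i.K hd hL) 0), x ∈ Q → x.shift κ ∈ Q → gaugeY i g U κ x = fluct (kGeo i).eta A κ x) →
      (∀ κ, ∀ x ∈ Q, ‖A κ x‖ ≤ C * ξ⁻¹) →
      (∀ μ ν, ∀ x ∈ Q, ‖(((kGeo i).eta : ℂ)⁻¹) • covD (shiftsV1 (PV d ℓ i.m i.K hd hL)) (fun _ _ => (1 : 𝔸ˣ)) μ (A ν) x‖ ≤ C * (ξ ^ 2)⁻¹) →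
      max C (C * (1 + D1 thetaProf)) * Λ ^ 2 ≤ a₁ → max C (C * (1 + D1 thetaProf)) * Λ ^ 2 ≤ 1 / 4 →
      (∀ x, ‖((g x : 𝔸ˣ) : 𝔸)‖ ≤ 1 ∧ ‖(((g x)⁻¹ : 𝔸ˣ) : 𝔸)‖ ≤ 1) →
    ∀ [Fintype (geoBK i).Site] (Rr : ℝ) (Hp : Prop),
      IsUnit (deltaPrimeACubeY i c (parSymY i) (locCfgY i c (kGeo i).eta A)) ∧
      HasMajorant (g := toB6 (geoBK i) Rr Hp) (fun p : SiteY i × ι => blkOf i.D.toDomains p.1) (conj b (Gmem i c g A))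
        (fun a a' => B₀ * (geoBK i).len a ^ 2 * Real.exp (-(δ * (geoBK i).dist a a'))) ∧
      (∀ μ : Fin (d + 1), HasMajorant (g := toB6 (geoBK i) Rr Hp) (fun p : SiteY i × ι => blkOf i.D.toDomains p.1)
        (conj b (diffLetter (shiftY i) (UboxY i U) ((((kGeo i).eta : ℂ))⁻¹) (Sum.inl μ)) * conj b (Gmem i c g A))
        (fun a a' => B₀ * (geoBK i).len a * Real.exp (-(δ * (geoBK i).dist a a')))) ∧
      (∀ μ : Fin (d + 1), HasMajorant (g := toB6 (geoBK i) Rr Hp) (fun p : SiteY i × ι => blkOf i.D.toDomains p.1)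
        (conj b (Gmem i c g A) * conj b (diffLetter (shiftY i) (UboxY i U) ((((kGeo i).eta : ℂ))⁻¹) (Sum.inr μ)))
        (fun a a' => B₀ * (geoBK i).len a * Real.exp (-(δ * (geoBK i).dist a a')))) ∧
      HasMajorant (g := toB6 (geoBK i) Rr Hp) (fun p : SiteY i × ι => blkOf i.D.toDomains p.1)
        (conj b (Lscaled i U) * conj b (Gmem i c g A))
        (fun a a' => B₀ * 1 * Real.exp (-(δ * (geoBK i).dist a a'))) := by
  have hSb : 0 ≤ ∑ j, ‖b j‖ := Finset.sum_nonneg fun _ _ => norm_nonneg _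
  have hD1 := D1_nonneg contDiff_thetaProf hasCompactSupport_thetaProf
  have hD2 := D2_nonneg contDiff_thetaProf hasCompactSupport_thetaProf
  obtain ⟨δC, Bf, M₀, T₀, N₀, hδC, hBf, a₁, ha₁, Hc⟩ := gp_cube_entries_at_locCfg b d ℓ hℓ M₂ hM₂ hrepr
  -- the constants: `P = (M₂Σ‖b_j‖)²`, `Λ4 = L⁴`, one constant per entry, `Bc` their sum
  obtain ⟨P, hP⟩ : ∃ P : ℝ, P = (M₂ * ∑ j, ‖b j‖) ^ 2 := ⟨_, rfl⟩
  have hP0 : 0 ≤ P := by rw [hP]; positivity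
  obtain ⟨C0, hC0⟩ : ∃ C0 : ℝ, C0 = P * (1 * 1 * Bf) := ⟨_, rfl⟩
  obtain ⟨C1, hC1⟩ : ∃ C1 : ℝ, C1 = P * (1 * 1 * Bf) + P * (D1 thetaProf / 4 * 1 * Bf) := ⟨_, rfl⟩
  obtain ⟨C2, hC2⟩ : ∃ C2 : ℝ, C2 = P * (1 * 1 * Bf) + P * (1 * (D1 thetaProf / 4) * Bf * (((ℓ : ℝ) + 1) ^ 4)) := ⟨_, rfl⟩
  obtain ⟨C3, hC3⟩ : ∃ C3 : ℝ, C3 = P * (1 * 1 * Bf) +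
      ((d : ℝ) + 1) * (P * (D1 thetaProf / 4 * 1 * Bf) + P * (D1 thetaProf / 4 * 1 * Bf) + P * (3 * D2 thetaProf / 16 * 1 * Bf)) := ⟨_, rfl⟩
  have hC00 : 0 ≤ C0 := by rw [hC0]; positivity
  have hC10 : 0 ≤ C1 := by rw [hC1]; positivity
  have hC20 : 0 ≤ C2 := by rw [hC2]; positivity
  have hC30 : 0 ≤ C3 := by rw [hC3]; positivity
  obtain ⟨Bc, hBc⟩ : ∃ Bc : ℝ, Bc = C0 + C1 + C2 + C3 := ⟨_, rfl⟩
  have hBc0 : 0 ≤ Bc := by rw [hBc]; positivity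
  have hc0 : C0 ≤ Bc := by rw [hBc]; linarith
  have hc1 : C1 ≤ Bc := by rw [hBc]; linarith
  have hc2 : C2 ≤ Bc := by rw [hBc]; linarith
  have hc3 : C3 ≤ Bc := by rw [hBc]; linarith
  -- the final rate `δ_f = (1 − 9/5000)δ_C`
  have hδf : (1 - 9 / 5000) * δC ≤ δC := by nlinarith
  have hδf0 : 0 < (1 - 9 / 5000) * δC := by positivity
  refine ⟨(1 - 9 / 5000) * δC, Bc, M₀, max T₀ (4 * Real.log ((ℓ : ℝ) + 1) / (9 / 5000 * δC)), N₀, hδf0, hBc0, a₁, ha₁, ?_⟩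
  intro hd hL b₀ b₁ i c hM hN hT g U A Q C ξ Λ hC hξ hΛ hξS hΛξ hQ hgA hA hdA hα₁ hα4 hg _ Rr Hp
  have hT₀ : T₀ ≤ RM1 i := (le_max_left _ _).trans hT
  have hTS : 4 * Real.log ((ℓ : ℝ) + 1) / (9 / 5000 * δC) ≤ RM1 i := (le_max_right _ _).trans hT
  obtain ⟨hunit, E0, E1, E2, E3⟩ := Hc i c Rr Hp hM hN hT₀ g U A Q C ξ Λ hC hξ hΛ hξS hΛξ hQ hgA hA hdA hα₁ hα4
  refine ⟨hunit, ?_⟩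
  -- the inputs of the sandwich transfer (T3)
  have hγ : ∀ (z : SiteY i) (a : 𝔸), ‖R (gSiteY i g z) a‖ ≤ ‖a‖ ∧ ‖R (gSiteY i g z)⁻¹ a‖ ≤ ‖a‖ := fun z a =>
    ⟨B9Eq310Hermitian.norm_R_le (hg _).1 (hg _).2 a, B9Eq310Hermitian.norm_R_inv_le (hg _).1 (hg _).2 a⟩
  have hNz := nearC_of_chiY_ne_zero₃ i c
  have hAG := agree_near i c (kGeo i).eta hQ hgA
  have hST := (hST_geoCK i c hδC hTS (9 / 5000) le_rfl).2.2.1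
  have hl : ∀ a : (geoBK i).Site, 0 ≤ (geoBK i).len a := fun a => (geoBK_len_pos i a).le
  -- the cube entries in the form `conj b (X * Ginner)`, `conj b (Ginner * X)`
  have E0' : HasMajorant (g := toB6 (geoCK i c) Rr Hp) (fun p : SiteY i × ι => blkCubeY i c p.1) (conj b (Ginner i c A))
      (fun a a' => Bf * (geoCK i c).len a ^ 2 * Real.exp (-(δC * (geoCK i c).dist a a'))) := E0
  have E1' : ∀ k : Fin (d + 1) ⊕ Fin (d + 1), HasMajorant (g := toB6 (geoCK i c) Rr Hp) (fun p : SiteY i × ι => blkCubeY i c p.1)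
      (conj b (diffLetter (shiftY i) (UboxY i (locCfgY i c (kGeo i).eta A)) ((((kGeo i).eta : ℂ))⁻¹) k * Ginner i c A))
      (fun a a' => Bf * (geoCK i c).len a ^ 1 * Real.exp (-(δC * (geoCK i c).dist a a'))) := fun k => by
    simpa only [pow_one, B9Eq352DivFormLetters.conj_mul, conj_Ginner] using E1 k
  have E2' : ∀ μ : Fin (d + 1), HasMajorant (g := toB6 (geoCK i c) Rr Hp) (fun p : SiteY i × ι => blkCubeY i c p.1)
      (conj b (Ginner i c A * diffLetter (shiftY i) (UboxY i (locCfgY i c (kGeo i).eta A)) ((((kGeo i).eta : ℂ))⁻¹) (Sum.inr μ)))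
      (fun a a' => Bf * (geoCK i c).len a ^ 1 * Real.exp (-(δC * (geoCK i c).dist a a'))) := fun μ => by
    simpa only [pow_one, B9Eq352DivFormLetters.conj_mul, conj_Ginner] using E2 μ
  have E3' : HasMajorant (g := toB6 (geoCK i c) Rr Hp) (fun p : SiteY i × ι => blkCubeY i c p.1)
      (conj b (Lscaled i (locCfgY i c (kGeo i).eta A) * Ginner i c A))
      (fun a a' => Bf * (geoCK i c).len a ^ 0 * Real.exp (-(δC * (geoCK i c).dist a a'))) := by
    simpa only [pow_zero, B9Eq352DivFormLetters.conj_mul, conj_Ginner, Lscaled] using E3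
  -- the multiplier sizes (FILE 7b-D1) and the supports (`NearH`)
  have hχ : ∀ z : SiteY i, |chiY i c z| ≤ 1 := fun z => (abs_chiY_le_one i c z).1
  have hχ0 : ∀ z : SiteY i, |chiY i c z| * (geoCK i c).len (blkCubeY i c z) ^ 0 ≤ 1 := fun z => by
    rw [pow_zero, mul_one]; exact hχ z
  have hχp : ∀ (μ : Fin (d + 1)) (z : SiteY i), |(fun z => chiY i c (shiftY i μ z)) z| ≤ 1 := fun μ z => (chiY_weights i c μ z).2.1
  have hχp0 : ∀ (μ : Fin (d + 1)) (z : SiteY i), |(fun z => chiY i c (shiftY i μ z)) z| * (geoCK i c).len (blkCubeY i c z) ^ 0 ≤ 1 :=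
    fun μ z => by rw [pow_zero, mul_one]; exact hχp μ z
  have hdp1 : ∀ (μ : Fin (d + 1)) (z : SiteY i),
      |(fun z => ((kGeo i).eta)⁻¹ * (chiY i c (shiftY i μ z) - chiY i c z)) z| * (geoCK i c).len (blkCubeY i c z) ^ 1 ≤ D1 thetaProf / 4 :=
    fun μ z => by rw [pow_one]; exact (chiY_weights i c μ z).2.2.2.1
  have hdn1 : ∀ (μ : Fin (d + 1)) (z : SiteY i),
      |(fun z => -(((kGeo i).eta)⁻¹ * (chiY i c (shiftY i μ z) - chiY i c z))) z| * (geoCK i c).len (blkCubeY i c z) ≤ D1 thetaProf / 4 :=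
    fun μ z => by beta_reduce; rw [abs_neg]; exact (chiY_weights i c μ z).2.2.2.1
  have hdm1 : ∀ (μ : Fin (d + 1)) (z : SiteY i),
      |(fun z => -(((kGeo i).eta)⁻¹ * (chiY i c ((shiftY i μ).symm z) - chiY i c z))) z| * (geoCK i c).len (blkCubeY i c z) ^ 1
        ≤ D1 thetaProf / 4 :=
    fun μ z => by beta_reduce; rw [pow_one, abs_neg]; exact (chiY_weights i c μ z).2.2.2.2.1
  have hdd2 : ∀ (μ : Fin (d + 1)) (z : SiteY i),
      |(fun z => ((kGeo i).eta ^ 2)⁻¹ * (chiY i c (shiftY i μ z) - 2 * chiY i c z + chiY i c ((shiftY i μ).symm z))) z|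
        * (geoCK i c).len (blkCubeY i c z) ^ 2 ≤ 3 * D2 thetaProf / 16 :=
    fun μ z => by beta_reduce; exact (chiY_weights i c μ z).2.2.2.2.2
  have hnχ : ∀ z : SiteY i, chiY i c z ≠ 0 → NearH c z.1 := fun z hz => nearH_of_chiY_ne_zero₃ i c 0 z (Or.inl hz)
  have hnχp : ∀ (μ : Fin (d + 1)) (z : SiteY i), (fun z => chiY i c (shiftY i μ z)) z ≠ 0 → NearH c z.1 := fun μ z hz =>
    nearH_of_chiY_ne_zero₃ i c μ z (Or.inr (Or.inl hz))
  have hndn : ∀ (μ : Fin (d + 1)) (z : SiteY i), (fun z => -(((kGeo i).eta)⁻¹ * (chiY i c (shiftY i μ z) - chiY i c z))) z ≠ 0 → NearH c z.1 := by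
    intro μ z hz
    refine nearH_of_chiY_ne_zero₃ i c μ z ?_
    by_contra hcon
    simp only [not_or, not_ne_iff] at hcon
    exact hz (by beta_reduce; rw [hcon.1, hcon.2.1, sub_self, mul_zero, neg_zero])
  -- (3.42)₁: `η²O_□ = Sand(χ, η²G′, χ)`
  have W0 : HasMajorant (g := toB6 (geoBK i) Rr Hp) (fun p : SiteY i × ι => blkOf i.D.toDomains p.1) (conj b (Gmem i c g A))
      (fun a a' => Bc * (geoBK i).len a ^ 2 * Real.exp (-((1 - 9 / 5000) * δC * (geoBK i).dist a a'))) := by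
    have T := hasMajorant_conj_site_sandwich_decay_blocks i c b hM₂ hrepr (gSiteY i g) hγ (chiY i c) (chiY i c) (c₁ := 1) (c₂ := 1)
      zero_le_one zero_le_one (m := 0) (n := 2) (by norm_num) hχ0 hχ hnχ Rr Hp Rr Hp hBf hδC.le (Ginner i c A) E0'
    refine hasMajorant_mono (g := toB6 (geoBK i) Rr Hp) _ T fun a a' => ?_
    rw [← hP, ← hC0]
    exact kernel_le (geoBK_dist_nonneg i a a') (pow_nonneg (hl a) _) (le_of_eq (by norm_num)) hc0 hBc0 hδf
  -- (3.42)₂: `(η⁻¹∇_{U,μ})(η²O_□)`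
  have W1 : ∀ μ : Fin (d + 1), HasMajorant (g := toB6 (geoBK i) Rr Hp) (fun p : SiteY i × ι => blkOf i.D.toDomains p.1)
      (conj b (diffLetter (shiftY i) (UboxY i U) ((((kGeo i).eta : ℂ))⁻¹) (Sum.inl μ)) * conj b (Gmem i c g A))
      (fun a a' => Bc * (geoBK i).len a * Real.exp (-((1 - 9 / 5000) * δC * (geoBK i).dist a a'))) := by
    intro μ
    have Ta := hasMajorant_conj_site_sandwich_decay_blocks i c b hM₂ hrepr (gSiteY i g) hγ (fun z => chiY i c (shiftY i μ z)) (chiY i c)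
      (c₁ := 1) (c₂ := 1) zero_le_one zero_le_one (m := 0) (n := 1) (by norm_num) (hχp0 μ) hχ hnχ Rr Hp Rr Hp hBf hδC.le
      (diffLetter (shiftY i) (UboxY i (locCfgY i c (kGeo i).eta A)) ((((kGeo i).eta : ℂ))⁻¹) (Sum.inl μ) * Ginner i c A) (E1' (Sum.inl μ))
    have Tb := hasMajorant_conj_site_sandwich_decay_blocks i c b hM₂ hrepr (gSiteY i g) hγ
      (fun z => ((kGeo i).eta)⁻¹ * (chiY i c (shiftY i μ z) - chiY i c z)) (chiY i c) (c₁ := D1 thetaProf / 4) (c₂ := 1) (by positivity)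
      zero_le_one (m := 1) (n := 2) (by norm_num) (hdp1 μ) hχ hnχ Rr Hp Rr Hp hBf hδC.le (Ginner i c A) E0'
    have hs := hasMajorant_congr_op (T' := conj b (diffLetter (shiftY i) (UboxY i U) ((((kGeo i).eta : ℂ))⁻¹) (Sum.inl μ)) * conj b (Gmem i c g A))
      (hasMajorant_add _ Ta Tb) (by rw [← B9Eq352DivFormLetters.conj_mul, diffLetter_inl_mul_Gmem i c g U A hNz hAG μ, conj_add])
    refine hasMajorant_mono (g := toB6 (geoBK i) Rr Hp) _ hs fun a a' => ?_
    have hd := geoBK_dist_nonneg i a a'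
    calc (M₂ * ∑ j, ‖b j‖) ^ 2 * (1 * 1 * Bf) * (geoBK i).len a ^ (1 - 0) * Real.exp (-(δC * (geoBK i).dist a a'))
          + (M₂ * ∑ j, ‖b j‖) ^ 2 * (D1 thetaProf / 4 * 1 * Bf) * (geoBK i).len a ^ (2 - 1) * Real.exp (-(δC * (geoBK i).dist a a'))
        ≤ P * (1 * 1 * Bf) * (geoBK i).len a * Real.exp (-((1 - 9 / 5000) * δC * (geoBK i).dist a a'))
          + P * (D1 thetaProf / 4 * 1 * Bf) * (geoBK i).len a * Real.exp (-((1 - 9 / 5000) * δC * (geoBK i).dist a a')) := by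
          rw [hP]
          exact add_le_add (kernel_le hd (pow_nonneg (hl a) _) (le_of_eq (by norm_num)) le_rfl (by positivity) hδf)
            (kernel_le hd (pow_nonneg (hl a) _) (le_of_eq (by norm_num)) le_rfl (by positivity) hδf)
      _ = C1 * (geoBK i).len a * Real.exp (-((1 - 9 / 5000) * δC * (geoBK i).dist a a')) := by rw [hC1]; ring
      _ ≤ Bc * (geoBK i).len a * Real.exp (-((1 - 9 / 5000) * δC * (geoBK i).dist a a')) :=
          mul_le_mul_of_nonneg_right (mul_le_mul_of_nonneg_right hc1 (hl a)) (Real.exp_nonneg _)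
  -- (3.42)₃: `(η²O_□)(−η⁻¹∇*_{U,μ})`
  have W2 : ∀ μ : Fin (d + 1), HasMajorant (g := toB6 (geoBK i) Rr Hp) (fun p : SiteY i × ι => blkOf i.D.toDomains p.1)
      (conj b (Gmem i c g A) * conj b (diffLetter (shiftY i) (UboxY i U) ((((kGeo i).eta : ℂ))⁻¹) (Sum.inr μ)))
      (fun a a' => Bc * (geoBK i).len a * Real.exp (-((1 - 9 / 5000) * δC * (geoBK i).dist a a'))) := by
    intro μ
    have Ta := hasMajorant_conj_site_sandwich_decay_blocks i c b hM₂ hrepr (gSiteY i g) hγ (chiY i c) (fun z => chiY i c (shiftY i μ z))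
      (c₁ := 1) (c₂ := 1) zero_le_one zero_le_one (m := 0) (n := 1) (by norm_num) hχ0 (hχp μ) (hnχp μ) Rr Hp Rr Hp hBf hδC.le
      (Ginner i c A * diffLetter (shiftY i) (UboxY i (locCfgY i c (kGeo i).eta A)) ((((kGeo i).eta : ℂ))⁻¹) (Sum.inr μ)) (E2' μ)
    have Tb := hasMajorant_conj_site_sandwich_decay_src_blocks i c b hM₂ hrepr (gSiteY i g) hγ (chiY i c)
      (fun z => -(((kGeo i).eta)⁻¹ * (chiY i c (shiftY i μ z) - chiY i c z))) (c₁ := 1) (c₂ := D1 thetaProf / 4) zero_le_one (by positivity)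
      hχ (hdn1 μ) (hndn μ) Rr Hp Rr Hp hBf hδC.le (by norm_num : (9 : ℝ) / 5000 ≤ 1) (by positivity : (0 : ℝ) ≤ ((ℓ : ℝ) + 1) ^ 4)
      hST (Ginner i c A) E0'
    have hs := hasMajorant_congr_op (T' := conj b (Gmem i c g A) * conj b (diffLetter (shiftY i) (UboxY i U) ((((kGeo i).eta : ℂ))⁻¹) (Sum.inr μ)))
      (hasMajorant_add _ Ta Tb) (by rw [← B9Eq352DivFormLetters.conj_mul, Gmem_mul_diffLetter_inr i c g U A hNz hAG μ, conj_add])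
    refine hasMajorant_mono (g := toB6 (geoBK i) Rr Hp) _ hs fun a a' => ?_
    have hd := geoBK_dist_nonneg i a a'
    calc (M₂ * ∑ j, ‖b j‖) ^ 2 * (1 * 1 * Bf) * (geoBK i).len a ^ (1 - 0) * Real.exp (-(δC * (geoBK i).dist a a'))
          + (M₂ * ∑ j, ‖b j‖) ^ 2 * (1 * (D1 thetaProf / 4) * Bf * ((ℓ : ℝ) + 1) ^ 4) * (geoBK i).len a *
            Real.exp (-((1 - 9 / 5000) * δC * (geoBK i).dist a a'))
        ≤ P * (1 * 1 * Bf) * (geoBK i).len a * Real.exp (-((1 - 9 / 5000) * δC * (geoBK i).dist a a'))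
          + P * (1 * (D1 thetaProf / 4) * Bf * ((ℓ : ℝ) + 1) ^ 4) * (geoBK i).len a *
            Real.exp (-((1 - 9 / 5000) * δC * (geoBK i).dist a a')) := by
          rw [hP]
          exact add_le_add (kernel_le hd (pow_nonneg (hl a) _) (le_of_eq (by norm_num)) le_rfl (by positivity) hδf) le_rfl
      _ = C2 * (geoBK i).len a * Real.exp (-((1 - 9 / 5000) * δC * (geoBK i).dist a a')) := by rw [hC2]; ring
      _ ≤ Bc * (geoBK i).len a * Real.exp (-((1 - 9 / 5000) * δC * (geoBK i).dist a a')) :=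
          mul_le_mul_of_nonneg_right (mul_le_mul_of_nonneg_right hc2 (hl a)) (Real.exp_nonneg _)
  -- (3.42)₄: `η⁻²Δ_U(η²O_□)`
  have W3 : HasMajorant (g := toB6 (geoBK i) Rr Hp) (fun p : SiteY i × ι => blkOf i.D.toDomains p.1)
      (conj b (Lscaled i U) * conj b (Gmem i c g A))
      (fun a a' => Bc * 1 * Real.exp (-((1 - 9 / 5000) * δC * (geoBK i).dist a a'))) := by
    have T0 := hasMajorant_conj_site_sandwich_decay_blocks i c b hM₂ hrepr (gSiteY i g) hγ (chiY i c) (chiY i c) (c₁ := 1) (c₂ := 1)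
      zero_le_one zero_le_one (m := 0) (n := 0) le_rfl hχ0 hχ hnχ Rr Hp Rr Hp hBf hδC.le
      (Lscaled i (locCfgY i c (kGeo i).eta A) * Ginner i c A) E3'
    have Ta := fun μ : Fin (d + 1) => hasMajorant_conj_site_sandwich_decay_blocks i c b hM₂ hrepr (gSiteY i g) hγ
      (fun z => ((kGeo i).eta)⁻¹ * (chiY i c (shiftY i μ z) - chiY i c z)) (chiY i c) (c₁ := D1 thetaProf / 4) (c₂ := 1) (by positivity)
      zero_le_one (m := 1) (n := 1) le_rfl (hdp1 μ) hχ hnχ Rr Hp Rr Hp hBf hδC.le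
      (diffLetter (shiftY i) (UboxY i (locCfgY i c (kGeo i).eta A)) ((((kGeo i).eta : ℂ))⁻¹) (Sum.inl μ) * Ginner i c A) (E1' (Sum.inl μ))
    have Tb := fun μ : Fin (d + 1) => hasMajorant_conj_site_sandwich_decay_blocks i c b hM₂ hrepr (gSiteY i g) hγ
      (fun z => -(((kGeo i).eta)⁻¹ * (chiY i c ((shiftY i μ).symm z) - chiY i c z))) (chiY i c) (c₁ := D1 thetaProf / 4) (c₂ := 1)
      (by positivity) zero_le_one (m := 1) (n := 1) le_rfl (hdm1 μ) hχ hnχ Rr Hp Rr Hp hBf hδC.le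
      (diffLetter (shiftY i) (UboxY i (locCfgY i c (kGeo i).eta A)) ((((kGeo i).eta : ℂ))⁻¹) (Sum.inr μ) * Ginner i c A) (E1' (Sum.inr μ))
    have Tc := fun μ : Fin (d + 1) => hasMajorant_conj_site_sandwich_decay_blocks i c b hM₂ hrepr (gSiteY i g) hγ
      (fun z => ((kGeo i).eta ^ 2)⁻¹ * (chiY i c (shiftY i μ z) - 2 * chiY i c z + chiY i c ((shiftY i μ).symm z))) (chiY i c)
      (c₁ := 3 * D2 thetaProf / 16) (c₂ := 1) (by positivity) zero_le_one (m := 2) (n := 2) le_rfl (hdd2 μ) hχ hnχ Rr Hp Rr Hp hBf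
      hδC.le (Ginner i c A) E0'
    have Tsum := hasMajorant_finset_sum (g := toB6 (geoBK i) Rr Hp) (fun p : SiteY i × ι => blkOf i.D.toDomains p.1) Finset.univ _ _
      fun μ _ => hasMajorant_add _ (hasMajorant_add _ (Ta μ) (Tb μ)) (Tc μ)
    have hs0 := hasMajorant_add _ T0 (hasMajorant_neg _ Tsum)
    rw [← sub_eq_add_neg] at hs0
    have hs := hasMajorant_congr_op (T' := conj b (Lscaled i U) * conj b (Gmem i c g A)) hs0 (by
      rw [← B9Eq352DivFormLetters.conj_mul, Lscaled_mul_Gmem i c g U A hNz hAG, conj_sub, conj_finset_sum]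
      simp only [conj_add, SandR])
    refine hasMajorant_mono (g := toB6 (geoBK i) Rr Hp) _ hs fun a a' => ?_
    have hd := geoBK_dist_nonneg i a a'
    have per : ∀ μ : Fin (d + 1),
        (M₂ * ∑ j, ‖b j‖) ^ 2 * (D1 thetaProf / 4 * 1 * Bf) * (geoBK i).len a ^ (1 - 1) * Real.exp (-(δC * (geoBK i).dist a a'))
          + (M₂ * ∑ j, ‖b j‖) ^ 2 * (D1 thetaProf / 4 * 1 * Bf) * (geoBK i).len a ^ (1 - 1) * Real.exp (-(δC * (geoBK i).dist a a'))
          + (M₂ * ∑ j, ‖b j‖) ^ 2 * (3 * D2 thetaProf / 16 * 1 * Bf) * (geoBK i).len a ^ (2 - 2) * Real.exp (-(δC * (geoBK i).dist a a'))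
        ≤ (P * (D1 thetaProf / 4 * 1 * Bf) + P * (D1 thetaProf / 4 * 1 * Bf) + P * (3 * D2 thetaProf / 16 * 1 * Bf)) * 1 *
            Real.exp (-((1 - 9 / 5000) * δC * (geoBK i).dist a a')) := by
      intro μ
      rw [hP]
      calc _ ≤ (M₂ * ∑ j, ‖b j‖) ^ 2 * (D1 thetaProf / 4 * 1 * Bf) * 1 * Real.exp (-((1 - 9 / 5000) * δC * (geoBK i).dist a a'))
            + (M₂ * ∑ j, ‖b j‖) ^ 2 * (D1 thetaProf / 4 * 1 * Bf) * 1 * Real.exp (-((1 - 9 / 5000) * δC * (geoBK i).dist a a'))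
            + (M₂ * ∑ j, ‖b j‖) ^ 2 * (3 * D2 thetaProf / 16 * 1 * Bf) * 1 * Real.exp (-((1 - 9 / 5000) * δC * (geoBK i).dist a a')) :=
            add_le_add (add_le_add (kernel_le hd (pow_nonneg (hl a) _) (le_of_eq (by norm_num)) le_rfl (by positivity) hδf)
              (kernel_le hd (pow_nonneg (hl a) _) (le_of_eq (by norm_num)) le_rfl (by positivity) hδf))
              (kernel_le hd (pow_nonneg (hl a) _) (le_of_eq (by norm_num)) le_rfl (by positivity) hδf)
        _ = _ := by ring
    calc (M₂ * ∑ j, ‖b j‖) ^ 2 * (1 * 1 * Bf) * (geoBK i).len a ^ (0 - 0) * Real.exp (-(δC * (geoBK i).dist a a'))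
          + ∑ μ : Fin (d + 1),
            ((M₂ * ∑ j, ‖b j‖) ^ 2 * (D1 thetaProf / 4 * 1 * Bf) * (geoBK i).len a ^ (1 - 1) * Real.exp (-(δC * (geoBK i).dist a a'))
              + (M₂ * ∑ j, ‖b j‖) ^ 2 * (D1 thetaProf / 4 * 1 * Bf) * (geoBK i).len a ^ (1 - 1) * Real.exp (-(δC * (geoBK i).dist a a'))
              + (M₂ * ∑ j, ‖b j‖) ^ 2 * (3 * D2 thetaProf / 16 * 1 * Bf) * (geoBK i).len a ^ (2 - 2) * Real.exp (-(δC * (geoBK i).dist a a')))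
        ≤ P * (1 * 1 * Bf) * 1 * Real.exp (-((1 - 9 / 5000) * δC * (geoBK i).dist a a'))
          + ∑ _μ : Fin (d + 1), (P * (D1 thetaProf / 4 * 1 * Bf) + P * (D1 thetaProf / 4 * 1 * Bf) + P * (3 * D2 thetaProf / 16 * 1 * Bf)) * 1 *
            Real.exp (-((1 - 9 / 5000) * δC * (geoBK i).dist a a')) := by
          refine add_le_add ?_ (Finset.sum_le_sum fun μ _ => per μ)
          rw [hP]
          exact kernel_le hd (pow_nonneg (hl a) _) (le_of_eq (by norm_num)) le_rfl (by positivity) hδf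
      _ = C3 * 1 * Real.exp (-((1 - 9 / 5000) * δC * (geoBK i).dist a a')) := by
          rw [Finset.sum_const, Finset.card_univ, Fintype.card_fin, nsmul_eq_mul, hC3]; push_cast; ring
      _ ≤ Bc * 1 * Real.exp (-((1 - 9 / 5000) * δC * (geoBK i).dist a a')) :=
          mul_le_mul_of_nonneg_right (mul_le_mul_of_nonneg_right hc3 zero_le_one) (Real.exp_nonneg _)
  exact ⟨W0, W1, W2, W3⟩

end Literature.MathematicalPhysics.QuantumFieldTheory.Balaban1983to89.B9Cor36GpCubeLocAtBlocks

end
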